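import Literature.MathematicalPhysics.KineticTheory.CollisionWindowStationarity
import Literature.MathematicalPhysics.KineticTheory.LocalGibbsConstEquivalence
import Literature.Probability.Process.CondExpInvariance
import Literature.MathematicalPhysics.KineticTheory.EvenStatTruncationBound
import Literature.MathematicalPhysics.KineticTheory.HardSphereTwoTimePressure
import Summits.AtomisticToContinuum.HydrodynamicLimit.Theorems.JParityClosureOddContactSymmetryGibbsInvariance
import Mathlib.Algebra.Order.Chebyshev
import HarnessLib

/-!
# Crux `InformationPercolationEngine.CollisionRate` (stmt-AtomisticToContinuum-13481), line `Sketch`: R0-aux —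
# hazard fairness at constant profiles from a one-window variance bound

Registered reduction stub `stub_hazardFairConstOfVarianceAux` of the lead's skeleton (`Cruxes/CollisionRate/Lines/Sketch.lean`):
measurability of the window counts (shape of helper H1) → their integrability under the invariant law (shape of H2) → the
one-window second-moment bound (V) → hazard fairness S1 at CONSTANT profiles.  For constant profiles the local Gibbs law
`G'` is invariant under every `Φ_t` (`measurePreserving_flow_localGibbsLaw_const`); the compensated window sum is
`Σ_{k<Kw} X_k`, `X_k = (ε/(N+1)) Σ_i h_{i,k}(p_k)(D_{i,k} − κ_{i,k})`, and `X_k = X_0^{(h_k)} ∘ Φ_{kw}` `G'`-a.e.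
(`D_{i,k} = D_{i,0} ∘ Φ_{kw}`, `p_k = p_0 ∘ Φ_{kw}` on the good set — `CollisionWindowStationarity`; `κ_{i,k} = κ_{i,0} ∘ Φ_{kw}`
a.e. by `Literature.Probability.Process.condExp_comp_of_measurePreserving_of_ae_eq` under the invariant law, transported by
`G' ≪ G`).  Markov on `(Σ X_k)²`, Cauchy–Schwarz `(Σ_{k<Kw} X_k)² ≤ Kw Σ X_k²`, stationarity and (V) give the bound
`(τσ/a + σ)² Cv C² a / ((N+1) η²) → 0` (`Kw ε ≤ τσ/a + σ`).  Lead prover-line-stmt-AtomisticToContinuum-13481-0.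
-/

noncomputable section
open MeasureTheory Set Filter
open scoped ENNReal BigOperators
namespace Summit.AtomisticToContinuum.HydrodynamicLimit.Theorems.CollisionRate

open Literature.Analysis.FluidPDE Literature.MathematicalPhysics.KineticTheory

/-! ### The compensated sum as a sum over windows -/
section Functionals

variable {σ : ℝ} {N : ℕ} (Φ : HardSphereFlow (Torus.geometry (Fin 3)) (hsDiameter σ N) (N + 1))

/-- **The compensated window sum is the sum of the window terms**: `WS(h, D) − WS(h, κ) = Σ_{k<Kw} X_k`. [folklore] -/
theorem windowSum_sub_eq_sum_windowTerm (r' τ a : ℝ) (h : Fin (N + 1) → ℕ → CoarseState N → ℝ)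
    (z : Config (N + 1) (Fin 3) T3) :
    windowSum σ N Φ r' τ a h (windowCollisions σ N Φ τ a) z - windowSum σ N Φ r' τ a h (windowHazard σ N Φ r' τ a) z =
      ∑ k ∈ Finset.range (windowNum N τ a), hsDiameter σ N / (N + 1 : ℝ) * ∑ i : Fin (N + 1),
        h i k (coarseStateAt σ N Φ r' τ a k z) * (windowCollisions σ N Φ τ a i k z - windowHazard σ N Φ r' τ a i k z) := by
  unfold windowSum
  rw [← mul_sub, ← Finset.sum_sub_distrib]
  have hinner : ∀ i : Fin (N + 1),
      (∑ k ∈ Finset.range (windowNum N τ a), h i k (coarseStateAt σ N Φ r' τ a k z) * windowCollisions σ N Φ τ a i k z) -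
        ∑ k ∈ Finset.range (windowNum N τ a), h i k (coarseStateAt σ N Φ r' τ a k z) * windowHazard σ N Φ r' τ a i k z =
      ∑ k ∈ Finset.range (windowNum N τ a), h i k (coarseStateAt σ N Φ r' τ a k z) *
        (windowCollisions σ N Φ τ a i k z - windowHazard σ N Φ r' τ a i k z) := by
    intro i
    rw [← Finset.sum_sub_distrib]
    refine Finset.sum_congr rfl fun k _ => ?_
    ring
  simp_rw [hinner]
  rw [Finset.sum_comm, Finset.mul_sum]

end Functionals

/-! ### Stationarity: the window-`k` term has the law of a window-`0` term -/
section Stationarity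

variable {σ : ℝ} {N : ℕ} (Φ : HardSphereFlow (Torus.geometry (Fin 3)) (hsDiameter σ N) (N + 1))

/-- **`κ_{i,k} = κ_{i,0} ∘ Φ_{kw}` a.e. under the invariant law** (conditional expectations commute with measure-preserving
maps; the comaps of `p_k` and `p_0 ∘ Φ_{kw}` agree off the null bad set; needs the window count integrable, helper H2). [folklore] -/
theorem windowHazard_ae_eq_comp_flow (hσ2 : σ ≤ 1 / 2) (r' τ a : ℝ) (i : Fin (N + 1)) (k : ℕ)
    (hint : Integrable (windowCollisions σ N Φ τ a i 0) (invariantLaw σ N Φ)) :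
    windowHazard σ N Φ r' τ a i k =ᵐ[invariantLaw σ N Φ]
      fun z => windowHazard σ N Φ r' τ a i 0 (Φ.flow ((k : ℝ) * windowLen N τ a) z) := by
  set G := invariantLaw σ N Φ with hG
  haveI : IsProbabilityMeasure G := by
    rw [hG, invariantLaw]; exact isProbabilityMeasure_localGibbsLaw_const one_pos hσ2 0 N Φ
  have hT : MeasurePreserving (Φ.flow ((k : ℝ) * windowLen N τ a)) G G := by
    rw [hG, invariantLaw]; exact measurePreserving_flow_localGibbsLaw_const σ 1 1 0 N Φ _
  have hgood : ∀ᵐ z ∂G, z ∈ Φ.good := by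
    rw [ae_iff]; exact localGibbsLaw_compl_good_eq_zero Φ
  -- the comaps: `p_k = p_0 ∘ Φ_{kw}` a.e.
  have hq : (coarseStateAt σ N Φ r' τ a k) =ᵐ[G]
      (coarseStateAt σ N Φ r' τ a 0) ∘ (Φ.flow ((k : ℝ) * windowLen N τ a)) := by
    filter_upwards [hgood] with z hz
    exact coarseStateAt_eq_coarseStateAt_zero_flow Φ hz r' τ a k
  -- `D_{i,k} = D_{i,0} ∘ Φ_{kw}` a.e.
  have hD : (windowCollisions σ N Φ τ a i k) =ᵐ[G]
      (windowCollisions σ N Φ τ a i 0) ∘ (Φ.flow ((k : ℝ) * windowLen N τ a)) := by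
    filter_upwards [hgood] with z hz
    exact windowCollisions_eq_windowCollisions_zero_flow Φ hz τ a i k
  -- the toolkit
  have key := Literature.Probability.Process.condExp_comp_of_measurePreserving_of_ae_eq (E := ℝ) hT
    (measurable_coarseStateAt σ N Φ r' τ a 0) (measurable_coarseStateAt σ N Φ r' τ a k) hq hint
  -- `κ_{i,k} = G[D_{i,k} | comap p_k] = G[D_{i,0} ∘ Φ_{kw} | comap p_k]` a.e.
  have h1 : windowHazard σ N Φ r' τ a i k =ᵐ[G]
      G[(windowCollisions σ N Φ τ a i 0) ∘ (Φ.flow ((k : ℝ) * windowLen N τ a)) |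
        MeasurableSpace.comap (coarseStateAt σ N Φ r' τ a k) inferInstance] := by
    unfold windowHazard
    exact condExp_congr_ae hD
  refine h1.trans (key.trans ?_)
  exact Filter.EventuallyEq.rfl

/-- **`X_k = X_0^{(k)} ∘ Φ_{kw}` a.e. under every constant-profile law** (`σ ≤ 1/2`). [folklore] -/
theorem windowTerm_ae_eq_comp_flow (hσ2 : σ ≤ 1 / 2) (ab θb : ℝ) (ub : V3)
    (r' τ a : ℝ) (h : Fin (N + 1) → ℕ → CoarseState N → ℝ) (k : ℕ)
    (hint : ∀ i, Integrable (windowCollisions σ N Φ τ a i 0) (invariantLaw σ N Φ)) :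
    (fun z => hsDiameter σ N / (N + 1 : ℝ) * ∑ i : Fin (N + 1), h i k (coarseStateAt σ N Φ r' τ a k z) *
        (windowCollisions σ N Φ τ a i k z - windowHazard σ N Φ r' τ a i k z))
      =ᵐ[localGibbsLaw σ (fun _ => ab) (fun _ => ub) (fun _ => θb) N Φ]
      fun z => hsDiameter σ N / (N + 1 : ℝ) * ∑ i : Fin (N + 1),
        h i k (coarseStateAt σ N Φ r' τ a 0 (Φ.flow ((k : ℝ) * windowLen N τ a) z)) *
        (windowCollisions σ N Φ τ a i 0 (Φ.flow ((k : ℝ) * windowLen N τ a) z) -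
          windowHazard σ N Φ r' τ a i 0 (Φ.flow ((k : ℝ) * windowLen N τ a) z)) := by
  set G' := localGibbsLaw σ (fun _ => ab) (fun _ => ub) (fun _ => θb) N Φ with hG'
  have hac : G' ≪ invariantLaw σ N Φ := by
    rw [hG', invariantLaw]
    exact localGibbsLaw_absolutelyContinuous_localGibbsLaw continuous_const continuous_const continuous_const
      (fun _ => one_pos) (fun _ => one_pos) _ _ _ hσ2 N Φ
  have hgood : ∀ᵐ z ∂G', z ∈ Φ.good := by
    rw [ae_iff]; exact localGibbsLaw_compl_good_eq_zero Φ
  have hκ : ∀ i, windowHazard σ N Φ r' τ a i k =ᵐ[G']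
      fun z => windowHazard σ N Φ r' τ a i 0 (Φ.flow ((k : ℝ) * windowLen N τ a) z) :=
    fun i => hac.ae_eq (windowHazard_ae_eq_comp_flow Φ hσ2 r' τ a i k (hint i))
  have hκ' : ∀ᵐ z ∂G', ∀ i, windowHazard σ N Φ r' τ a i k z =
      windowHazard σ N Φ r' τ a i 0 (Φ.flow ((k : ℝ) * windowLen N τ a) z) :=
    ae_all_iff.2 hκ
  filter_upwards [hgood, hκ'] with z hz hzκ
  congr 1
  refine Finset.sum_congr rfl fun i _ => ?_
  rw [coarseStateAt_eq_coarseStateAt_zero_flow Φ hz r' τ a k, windowCollisions_eq_windowCollisions_zero_flow Φ hz τ a i k, hzκ i]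

end Stationarity

/-! ### Measurability of the window terms -/
section Measurability

variable {σ : ℝ} {N : ℕ} (Φ : HardSphereFlow (Torus.geometry (Fin 3)) (hsDiameter σ N) (N + 1))

/-- The window hazard (a conditional expectation w.r.t. a sub-σ-algebra) is measurable. [folklore] -/
theorem measurable_windowHazard (r' τ a : ℝ) (i : Fin (N + 1)) (k : ℕ) :
    Measurable (windowHazard σ N Φ r' τ a i k) := by
  unfold windowHazard
  exact stronglyMeasurable_condExp.measurable.mono (comap_coarseStateAt_le σ N Φ r' τ a k) le_rfl

/-- The window-`0` functional is measurable (given measurable window counts). [folklore] -/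
theorem measurable_windowTermZero (r' τ a : ℝ) {h : Fin (N + 1) → ℕ → CoarseState N → ℝ}
    (hmeas : ∀ i k, Measurable (h i k)) (hmeasD : ∀ i k, Measurable (windowCollisions σ N Φ τ a i k)) (k : ℕ) :
    Measurable (fun z => hsDiameter σ N / (N + 1 : ℝ) * ∑ i : Fin (N + 1), h i k (coarseStateAt σ N Φ r' τ a 0 z) *
      (windowCollisions σ N Φ τ a i 0 z - windowHazard σ N Φ r' τ a i 0 z)) := by
  refine measurable_const.mul (Finset.measurable_sum _ fun i _ => ?_)
  exact ((hmeas i k).comp (measurable_coarseStateAt σ N Φ r' τ a 0)).mul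
    ((hmeasD i 0).sub (measurable_windowHazard Φ r' τ a i 0))

/-- The window-`k` term is measurable (given measurable window counts). [folklore] -/
theorem measurable_windowTerm (r' τ a : ℝ) {h : Fin (N + 1) → ℕ → CoarseState N → ℝ}
    (hmeas : ∀ i k, Measurable (h i k)) (hmeasD : ∀ i k, Measurable (windowCollisions σ N Φ τ a i k)) (k : ℕ) :
    Measurable (fun z => hsDiameter σ N / (N + 1 : ℝ) * ∑ i : Fin (N + 1), h i k (coarseStateAt σ N Φ r' τ a k z) *
      (windowCollisions σ N Φ τ a i k z - windowHazard σ N Φ r' τ a i k z)) := by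
  refine measurable_const.mul (Finset.measurable_sum _ fun i _ => ?_)
  exact ((hmeas i k).comp (measurable_coarseStateAt σ N Φ r' τ a k)).mul
    ((hmeasD i k).sub (measurable_windowHazard Φ r' τ a i k))

end Measurability

/-! ### The reduction -/
section Reduction

/-- Scales: `Kw · ε ≤ τσ/a + σ` (`Kw ≤ τ (N+1)^{1/3}/a + 1`, `ε = σ (N+1)^{-1/3} ≤ σ`). [folklore] -/
theorem windowNum_mul_hsDiameter_le {σ τ a : ℝ} (hσ : 0 ≤ σ) (hτ : 0 < τ) (ha : 0 < a) (N : ℕ) :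
    (windowNum N τ a : ℝ) * hsDiameter σ N ≤ τ * σ / a + σ := by
  have hN : (0 : ℝ) < ((N + 1 : ℕ) : ℝ) := by positivity
  set q : ℝ := ((N + 1 : ℕ) : ℝ) ^ (-(1 / 3 : ℝ)) with hq
  have hq0 : 0 < q := Real.rpow_pos_of_pos hN _
  have hq1 : q ≤ 1 := by
    rw [hq]
    exact Real.rpow_le_one_of_one_le_of_nonpos (by exact_mod_cast Nat.succ_le_succ (Nat.zero_le N)) (by norm_num)
  have hε : hsDiameter σ N = σ * q := rfl
  have hKw : (windowNum N τ a : ℝ) ≤ τ / (a * q) + 1 := by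
    unfold windowNum
    have h0 : 0 ≤ τ / (a * q) := by positivity
    exact (Nat.ceil_lt_add_one h0).le
  calc (windowNum N τ a : ℝ) * hsDiameter σ N ≤ (τ / (a * q) + 1) * (σ * q) := by
        rw [hε]; exact mul_le_mul_of_nonneg_right hKw (by positivity)
    _ = τ * σ / a + σ * q := by field_simp
    _ ≤ τ * σ / a + σ := by nlinarith

/-- **R0-aux**: window counts measurable (H1) → integrable under the invariant law (H2) → (V) ⇒ S1 at constant profiles. [folklore] -/
theorem stub_hazardFairConstOfVarianceAux :
    (∀ (σ : ℝ) (N : ℕ) (Φ : HardSphereFlow (Torus.geometry (Fin 3)) (hsDiameter σ N) (N + 1)) (τ a : ℝ)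
      (i : Fin (N + 1)) (k : ℕ), 0 < σ → σ < 1 / 2 → Measurable (windowCollisions σ N Φ τ a i k)) →
    (∃ σH : ℝ, 0 < σH ∧ ∀ σ : ℝ, 0 < σ → σ < σH →
      ∀ (N : ℕ) (Φ : HardSphereFlow (Torus.geometry (Fin 3)) (hsDiameter σ N) (N + 1)) (τ a : ℝ) (i : Fin (N + 1)),
      1 ≤ N → 0 < τ → 0 < a → Integrable (windowCollisions σ N Φ τ a i 0) (invariantLaw σ N Φ)) →
    (∃ σ₀ : ℝ, 0 < σ₀ ∧ ∀ σ : ℝ, 0 < σ → σ < σ₀ → ∀ (ab θb : ℝ) (ub : V3), 0 < ab → 0 < θb →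
      ∃ Cv : ℝ, ∀ (N : ℕ) (Φ : HardSphereFlow (Torus.geometry (Fin 3)) (hsDiameter σ N) (N + 1))
        (τ a r' : ℝ), 0 < τ → 0 < a → 0 < r' → ∀ C : ℝ, 0 ≤ C →
        ∀ h : Fin (N + 1) → ℕ → CoarseState N → ℝ, (∀ i k, Measurable (h i k)) → (∀ i k p, |h i k p| ≤ C) →
        ∫⁻ z, ENNReal.ofReal ((∑ i : Fin (N + 1), h i 0 (coarseStateAt σ N Φ r' τ a 0 z) *
            (windowCollisions σ N Φ τ a i 0 z - windowHazard σ N Φ r' τ a i 0 z)) ^ 2)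
          ∂(localGibbsLaw σ (fun _ => ab) (fun _ => ub) (fun _ => θb) N Φ) ≤
          ENNReal.ofReal (Cv * C ^ 2 * ((N + 1 : ℕ) : ℝ) * a)) →
    ∀ (ab θb : ℝ) (ub : V3), 0 < ab → 0 < θb → ∃ σ₀ : ℝ, 0 < σ₀ ∧ ∀ σ : ℝ, 0 < σ → σ < σ₀ →
      ∀ Φ : (N : ℕ) → HardSphereFlow (Torus.geometry (Fin 3)) (hsDiameter σ N) (N + 1),
      ∀ τ : ℝ, 0 < τ → ∀ a : ℝ, 0 < a → ∀ r' : ℝ, 0 < r' →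
      ∀ η δ : ℝ, 0 < η → 0 < δ → ∀ C : ℝ, 0 ≤ C → ∃ N₀ : ℕ, ∀ N : ℕ, N₀ ≤ N →
      ∀ h : Fin (N + 1) → ℕ → CoarseState N → ℝ,
        (∀ i k, Measurable (h i k)) → (∀ i k p, |h i k p| ≤ C) →
        localGibbsLaw σ (fun _ => ab) (fun _ => ub) (fun _ => θb) N (Φ N)
          {z | η < |windowSum σ N (Φ N) r' τ a h (windowCollisions σ N (Φ N) τ a) z -
              windowSum σ N (Φ N) r' τ a h (windowHazard σ N (Φ N) r' τ a) z|}
          ≤ ENNReal.ofReal δ := by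
  intro hH1 hH2 hV ab θb ub hab hθb
  obtain ⟨σV, hσV, HV⟩ := hV
  obtain ⟨σH, hσH, HH⟩ := hH2
  refine ⟨min (min σV σH) (1 / 2), lt_min (lt_min hσV hσH) (by norm_num), ?_⟩
  intro σ hσ hσlt Φ τ hτ a ha r' hr' η δ hη hδ C hC
  have hσV' : σ < σV := lt_of_lt_of_le hσlt ((min_le_left _ _).trans (min_le_left _ _))
  have hσH' : σ < σH := lt_of_lt_of_le hσlt ((min_le_left _ _).trans (min_le_right _ _))
  have hσ2 : σ < 1 / 2 := lt_of_lt_of_le hσlt (min_le_right _ _)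
  obtain ⟨Cv, HV⟩ := HV σ hσ hσV' ab θb ub hab hθb
  -- the constants
  set b : ℝ := τ * σ / a + σ with hb
  set Cv' : ℝ := max Cv 0 with hCv'
  have hCv'0 : 0 ≤ Cv' := le_max_right _ _
  set M : ℝ := b ^ 2 * Cv' * C ^ 2 * a / (η ^ 2 * δ) with hM
  have hM0 : 0 ≤ M := by positivity
  refine ⟨max 1 ⌈M⌉₊, fun N hN h hmeas hbdd => ?_⟩
  have hN1 : 1 ≤ N := (le_max_left _ _).trans hN
  have hNM : M ≤ (N : ℝ) := (Nat.le_ceil M).trans (by exact_mod_cast (le_max_right _ _).trans hN)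
  -- names
  set P := localGibbsLaw σ (fun _ => ab) (fun _ => ub) (fun _ => θb) N (Φ N) with hP
  set Kw : ℕ := windowNum N τ a with hKw
  set ε : ℝ := hsDiameter σ N with hε
  have hmeasD : ∀ i k, Measurable (windowCollisions σ N (Φ N) τ a i k) :=
    fun i k => hH1 σ N (Φ N) τ a i k hσ hσ2
  have hint : ∀ i, Integrable (windowCollisions σ N (Φ N) τ a i 0) (invariantLaw σ N (Φ N)) :=
    fun i => HH σ hσ hσH' N (Φ N) τ a i hN1 hτ ha
  set X : ℕ → Config (N + 1) (Fin 3) T3 → ℝ := fun k z => hsDiameter σ N / (N + 1 : ℝ) * ∑ i : Fin (N + 1),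
    h i k (coarseStateAt σ N (Φ N) r' τ a k z) * (windowCollisions σ N (Φ N) τ a i k z - windowHazard σ N (Φ N) r' τ a i k z)
    with hX
  set X0 : ℕ → Config (N + 1) (Fin 3) T3 → ℝ := fun k z => hsDiameter σ N / (N + 1 : ℝ) * ∑ i : Fin (N + 1),
    h i k (coarseStateAt σ N (Φ N) r' τ a 0 z) * (windowCollisions σ N (Φ N) τ a i 0 z - windowHazard σ N (Φ N) r' τ a i 0 z)
    with hX0
  have hXm : ∀ k, Measurable (X k) := fun k => measurable_windowTerm (Φ N) r' τ a hmeas hmeasD k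
  have hX0m : ∀ k, Measurable (X0 k) := fun k => measurable_windowTermZero (Φ N) r' τ a hmeas hmeasD k
  -- stationarity of each term, transported through `x ↦ ofReal (x²)`
  have hT : ∀ k, MeasurePreserving ((Φ N).flow ((k : ℝ) * windowLen N τ a)) P P := fun k => by
    rw [hP]; exact measurePreserving_flow_localGibbsLaw_const σ ab θb ub N (Φ N) _
  have hstat : ∀ k, ∫⁻ z, ENNReal.ofReal ((X k z) ^ 2) ∂P = ∫⁻ z, ENNReal.ofReal ((X0 k z) ^ 2) ∂P := by
    intro k
    have hae := windowTerm_ae_eq_comp_flow (Φ N) hσ2.le ab θb ub r' τ a h k hint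
    calc ∫⁻ z, ENNReal.ofReal ((X k z) ^ 2) ∂P
        = ∫⁻ z, ENNReal.ofReal ((X0 k ((Φ N).flow ((k : ℝ) * windowLen N τ a) z)) ^ 2) ∂P := by
          refine lintegral_congr_ae ?_
          filter_upwards [hae] with z hz
          simp only [hX, hX0] at hz ⊢
          rw [hz]
      _ = ∫⁻ z, ENNReal.ofReal ((X0 k z) ^ 2) ∂P :=
          (hT k).lintegral_comp ((hX0m k).pow_const 2).ennreal_ofReal
  -- (V) for each window's weight
  have hVk : ∀ k, ∫⁻ z, ENNReal.ofReal ((X0 k z) ^ 2) ∂P ≤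
      ENNReal.ofReal ((ε / (N + 1 : ℝ)) ^ 2 * (Cv' * C ^ 2 * ((N + 1 : ℕ) : ℝ) * a)) := by
    intro k
    have hVk0 := HV N (Φ N) τ a r' hτ ha hr' C hC (fun i _ p => h i k p) (fun i _ => hmeas i k)
      (fun i _ p => hbdd i k p)
    have hsplit : ∀ z, ENNReal.ofReal ((X0 k z) ^ 2) = ENNReal.ofReal ((ε / (N + 1 : ℝ)) ^ 2) *
        ENNReal.ofReal ((∑ i : Fin (N + 1), h i k (coarseStateAt σ N (Φ N) r' τ a 0 z) *
          (windowCollisions σ N (Φ N) τ a i 0 z - windowHazard σ N (Φ N) r' τ a i 0 z)) ^ 2) := by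
      intro z
      rw [← ENNReal.ofReal_mul (sq_nonneg _)]
      congr 1
      simp only [hX0, hε]
      ring
    simp_rw [hsplit]
    rw [lintegral_const_mul _ (by
      refine (Measurable.pow_const ?_ 2).ennreal_ofReal
      exact Finset.measurable_sum _ fun i _ => ((hmeas i k).comp (measurable_coarseStateAt σ N (Φ N) r' τ a 0)).mul
        ((hmeasD i 0).sub (measurable_windowHazard (Φ N) r' τ a i 0)))]
    rw [ENNReal.ofReal_mul (sq_nonneg _)]
    refine mul_le_mul_right (hVk0.trans (ENNReal.ofReal_le_ofReal ?_)) _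
    have : Cv * C ^ 2 * ((N + 1 : ℕ) : ℝ) * a ≤ Cv' * C ^ 2 * ((N + 1 : ℕ) : ℝ) * a := by
      have hCC : 0 ≤ C ^ 2 * ((N + 1 : ℕ) : ℝ) * a := by positivity
      nlinarith [le_max_left Cv 0]
    exact this
  -- Cauchy–Schwarz in k and Markov
  have hdecomp : ∀ z, windowSum σ N (Φ N) r' τ a h (windowCollisions σ N (Φ N) τ a) z -
      windowSum σ N (Φ N) r' τ a h (windowHazard σ N (Φ N) r' τ a) z = ∑ k ∈ Finset.range Kw, X k z :=
    fun z => windowSum_sub_eq_sum_windowTerm (Φ N) r' τ a h z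
  set F : Config (N + 1) (Fin 3) T3 → ℝ≥0∞ := fun z => ENNReal.ofReal ((∑ k ∈ Finset.range Kw, X k z) ^ 2) with hF
  have hFm : Measurable F := ((Finset.measurable_sum _ fun k _ => hXm k).pow_const 2).ennreal_ofReal
  have hsub : {z | η < |windowSum σ N (Φ N) r' τ a h (windowCollisions σ N (Φ N) τ a) z -
      windowSum σ N (Φ N) r' τ a h (windowHazard σ N (Φ N) r' τ a) z|} ⊆ {z | ENNReal.ofReal (η ^ 2) ≤ F z} := by
    intro z hz
    simp only [Set.mem_setOf_eq] at hz ⊢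
    rw [hdecomp z] at hz
    refine ENNReal.ofReal_le_ofReal ?_
    have h1 : η ^ 2 < (∑ k ∈ Finset.range Kw, X k z) ^ 2 := by
      calc η ^ 2 < |∑ k ∈ Finset.range Kw, X k z| ^ 2 := by gcongr
        _ = (∑ k ∈ Finset.range Kw, X k z) ^ 2 := sq_abs _
    exact h1.le
  have hη2 : ENNReal.ofReal (η ^ 2) ≠ 0 := by
    rw [ne_eq, ENNReal.ofReal_eq_zero, not_le]; positivity
  -- the lintegral bound
  have hlin : ∫⁻ z, F z ∂P ≤ ENNReal.ofReal ((Kw : ℝ) * ((Kw : ℝ) * ((ε / (N + 1 : ℝ)) ^ 2 *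
      (Cv' * C ^ 2 * ((N + 1 : ℕ) : ℝ) * a)))) := by
    have hpt : ∀ z, F z ≤ ENNReal.ofReal (Kw : ℝ) * ∑ k ∈ Finset.range Kw, ENNReal.ofReal ((X k z) ^ 2) := by
      intro z
      rw [hF, ← ENNReal.ofReal_sum_of_nonneg (fun k _ => sq_nonneg _), ← ENNReal.ofReal_mul (Nat.cast_nonneg _)]
      refine ENNReal.ofReal_le_ofReal ?_
      have := sq_sum_le_card_mul_sum_sq (s := Finset.range Kw) (f := fun k => X k z)
      simpa [Finset.card_range] using this
    calc ∫⁻ z, F z ∂P ≤ ∫⁻ z, ENNReal.ofReal (Kw : ℝ) * ∑ k ∈ Finset.range Kw, ENNReal.ofReal ((X k z) ^ 2) ∂P :=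
          lintegral_mono hpt
      _ = ENNReal.ofReal (Kw : ℝ) * ∑ k ∈ Finset.range Kw, ∫⁻ z, ENNReal.ofReal ((X k z) ^ 2) ∂P := by
          rw [lintegral_const_mul _ (Finset.measurable_sum _ fun k _ => ((hXm k).pow_const 2).ennreal_ofReal),
            lintegral_finsetSum _ fun k _ => ((hXm k).pow_const 2).ennreal_ofReal]
      _ ≤ ENNReal.ofReal (Kw : ℝ) * ∑ k ∈ Finset.range Kw,
            ENNReal.ofReal ((ε / (N + 1 : ℝ)) ^ 2 * (Cv' * C ^ 2 * ((N + 1 : ℕ) : ℝ) * a)) := by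
          gcongr with k hk
          rw [hstat k]
          exact hVk k
      _ = ENNReal.ofReal ((Kw : ℝ) * ((Kw : ℝ) * ((ε / (N + 1 : ℝ)) ^ 2 *
            (Cv' * C ^ 2 * ((N + 1 : ℕ) : ℝ) * a)))) := by
          rw [Finset.sum_const, Finset.card_range, nsmul_eq_mul, ← ENNReal.ofReal_natCast Kw,
            ← ENNReal.ofReal_mul (Nat.cast_nonneg _), ← ENNReal.ofReal_mul (Nat.cast_nonneg _)]
  -- Markov and the arithmetic
  calc P {z | η < |windowSum σ N (Φ N) r' τ a h (windowCollisions σ N (Φ N) τ a) z -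
          windowSum σ N (Φ N) r' τ a h (windowHazard σ N (Φ N) r' τ a) z|}
      ≤ P {z | ENNReal.ofReal (η ^ 2) ≤ F z} := measure_mono hsub
    _ ≤ (∫⁻ z, F z ∂P) / ENNReal.ofReal (η ^ 2) := meas_ge_le_lintegral_div hFm.aemeasurable hη2 ENNReal.ofReal_ne_top
    _ ≤ ENNReal.ofReal ((Kw : ℝ) * ((Kw : ℝ) * ((ε / (N + 1 : ℝ)) ^ 2 *
          (Cv' * C ^ 2 * ((N + 1 : ℕ) : ℝ) * a)))) / ENNReal.ofReal (η ^ 2) := by gcongr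
    _ = ENNReal.ofReal ((Kw : ℝ) * ((Kw : ℝ) * ((ε / (N + 1 : ℝ)) ^ 2 *
          (Cv' * C ^ 2 * ((N + 1 : ℕ) : ℝ) * a))) / η ^ 2) := (ENNReal.ofReal_div_of_pos (by positivity)).symm
    _ ≤ ENNReal.ofReal δ := by
        refine ENNReal.ofReal_le_ofReal ?_
        -- real arithmetic: `Kw ε ≤ b`, so the numerator is `≤ b² Cv' C² a /(N+1)`, and `M ≤ N`
        have hKε : (Kw : ℝ) * ε ≤ b := windowNum_mul_hsDiameter_le hσ.le hτ ha N
        have hKε0 : 0 ≤ (Kw : ℝ) * ε := mul_nonneg (Nat.cast_nonneg _) (hsDiameter_pos hσ N).le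
        have hN0 : (0 : ℝ) < (N + 1 : ℝ) := by positivity
        have hcast : ((N + 1 : ℕ) : ℝ) = (N + 1 : ℝ) := by push_cast; ring
        rw [hcast]
        have hb2 : ((Kw : ℝ) * ε) ^ 2 ≤ b ^ 2 := pow_le_pow_left₀ hKε0 hKε 2
        have hMN : M ≤ (N + 1 : ℝ) := hNM.trans (by linarith)
        have hM' : b ^ 2 * Cv' * C ^ 2 * a ≤ δ * η ^ 2 * (N + 1 : ℝ) := by
          have := (div_le_iff₀ (by positivity : (0 : ℝ) < η ^ 2 * δ)).1 hMN
          nlinarith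
        rw [div_le_iff₀ (by positivity : (0 : ℝ) < η ^ 2)]
        have hCa : 0 ≤ Cv' * C ^ 2 * a := by positivity
        calc (Kw : ℝ) * ((Kw : ℝ) * ((ε / (N + 1 : ℝ)) ^ 2 * (Cv' * C ^ 2 * (N + 1 : ℝ) * a)))
            = ((Kw : ℝ) * ε) ^ 2 * (Cv' * C ^ 2 * a) / (N + 1 : ℝ) := by
              field_simp
          _ ≤ b ^ 2 * (Cv' * C ^ 2 * a) / (N + 1 : ℝ) := by gcongr
          _ ≤ δ * η ^ 2 := by
              rw [div_le_iff₀ hN0]; nlinarith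

end Reduction

end Summit.AtomisticToContinuum.HydrodynamicLimit.Theorems.CollisionRate

end
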